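import Literature.Probability.RandomPlanarGeometry.HexSAWStripSurfaceLimits
import HarnessLib

/-!
# The three boundary classes of `S_{T,L}` share the threshold `y_T` (BBdGDCG14, Corollary 8 — common-radius clause at `x = x_c`, weak form)

Topic `Literature/Probability/RandomPlanarGeometry` (continues the capstone `HexSAWSurfaceFugacity.lean` — via `HexSAWStripSurfaceLimits.lean`,
whose `HV.stripGFy_nonneg'` is reused —: `HV.stripBddSet T` = the
fugacities `y ≥ 0` at which the critical `y`-weighted BRIDGE class `L ↦ B_{T,L}(x_c; y)` of the Duminil-Copin–Smirnov strip stays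
bounded, `HV.stripYT T = sSup (stripBddSet T)` = the lane's `y_T`; and BBdGDCG's identity (16) = `HV.stripIdentityY_holds` of
`HexSAWStripIdentityY.lean`: `cos(3π/8) A_{T,L}(x_c;y) + cos(π/4) E_{T,L}(x_c;y) + β(y) B_{T,L}(x_c;y) = 1`).  Source: N. R. Beaton,
M. Bousquet-Mélou, J. de Gier, H. Duminil-Copin, A. J. Guttmann, *The critical fugacity for surface adsorption of self-avoiding walks
on the honeycomb lattice is `1 + √2`*, Comm. Math. Phys. 326 (2014), arXiv:1109.0358v5, §3.2, Corollary 8 (p. 12): "The series (in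
`y`) `A_T(x_c, y)`, `B_T(x_c, y)` and `C_T(x_c, y)` have radius of convergence `y_T`" (the common-radius clause; printed proof via the
common radius `ρ_T(y) = 1/μ_T(1,y)` in `x` of Propositions 6–7; proof p. 13: "The argument is the same for the three series").
The mechanism below is the printed §4.2 step (arXiv v5 p. 14: "Let us fix T, and set y = y* in (16). Since β(y*) = 0, we obtain:
1 = α A_{T,L}(x_c;y*) + ε E_{T,L}(x_c;y*). … Since the coefficients α and ε are positive, the above identity shows that
A_{T,L}(x_c;y*) remains bounded as L increases.") with the β-term carried to the right-hand side for a general y.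

What is proved here, directly from the identity (16) and without growth rates: at `x = x_c` the boundedness in `L` of the
bridge class `B_{T,L}(x_c; y)` is EQUIVALENT to the boundedness of the full boundary class `A_{T,L} + B_{T,L} + E_{T,L}` (arches + bridges +
side exits of the trapezoid `S_{T,L}`), and IMPLIES the boundedness of the arch class and of the side class; so the boundedness
set defining `y_T` is the same for `B` and for `A + B + E`, and the arch class is bounded on all of it.  (For `y ≤ y*` every term
of (16) is nonnegative; for `y > y*` the identity reads `cos(3π/8) A + cos(π/4) E = 1 + |β(y)| B`.)

## Main statements (namespace `Literature.Probability.RandomPlanarGeometry.SAW.HV`, all proved; `T ≥ 1`)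

* `stripGFy_alpha_eps_le_of_beta_le` — `c_α A_{T,L}(y) + c_ε E_{T,L}(y) ≤ 1 + |β(y)| K` whenever
  `B_{T,L}(y) ≤ K` (`y > 0`); `stripGFy_alpha_le_of_beta_le`, `stripGFy_eps_le_of_beta_le`;
* `bddAbove_stripGFy_alpha_of_beta`, `bddAbove_stripGFy_eps_of_beta` — bounded bridges ⇒ bounded arches / side exits (`y ≥ 0`);
* **`bddAbove_stripGFy_all_iff`** — `L ↦ A + B + E` bounded ↔ `L ↦ B` bounded (`y ≥ 0`);
* **`stripBddSet_eq_all`** — `stripBddSet T = {y ≥ 0 : L ↦ A_{T,L}(x_c;y) + B_{T,L}(x_c;y) + E_{T,L}(x_c;y) bounded}`, hence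
  **`stripYT_eq_sSup_all`**: `y_T` is also the threshold of the full boundary class;
* `stripBddSet_subset_alpha` — on the whole boundedness set the arch class is bounded (the `≥` half of "`A_T(x_c, ·)` has radius
  `y_T`"; the `≤` half would need a control of the side class by the arch class and is not claimed).

Status in print / scope: the printed clause is about the three full series `A_T, B_T, C_T` and their common radius in `y` at `x = x_c`,
via growth rates; here only the `x = x_c` boundedness sets of the lane's finite-strip classes are compared, by the identity (16)
alone — label of record (lit-1 g14, 2026-08-23): CONSOLIDATION BY A DIFFERENT PROOF, WEAK/PARTIAL FORM; nothing new in writing beyond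
lane bookkeeping (`stripYT_eq_sSup_all` is a statement about the lane's own `y_T`).  Lane «pcv-sawmu», a-p2 g9.
-/

noncomputable section

open Finset Filter Topology

namespace Literature.Probability.RandomPlanarGeometry.SAW.HV

/-- **From the identity (16): `c_α A_{T,L}(x_c;y) + c_ε E_{T,L}(x_c;y) ≤ 1 + |β(y)| · K` whenever `B_{T,L}(x_c;y) ≤ K`** (`T ≥ 1`,
`y > 0`) — the printed §4.2 step at `y = y*` with the `β`-term carried to the right for general `y`.
[cite: BeatonBousquetMelouDeGierDuminilCopinGuttmann2014, §4.1 eq. (16) (arXiv v5 p. 13) = Proposition 4 eq. (11) at n = 0 (p. 7); §4.2 (p. 14: "Since the coefficients α and ε are positive, the above identity shows that A_{T,L}(x_c;y*) remains bounded")] -/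
theorem stripGFy_alpha_eps_le_of_beta_le {T : ℕ} (hT : 1 ≤ T) (L : ℕ) {y K : ℝ} (hy : 0 < y)
    (hB : stripGFy T L (IsBetaDart T) y ≤ K) :
    Real.cos (3 * Real.pi / 8) * stripGFy T L IsAlphaDart y + Real.cos (Real.pi / 4) * stripGFy T L (IsEpsDart L) y ≤
      1 + |betaY y| * K := by
  have hid := stripIdentityY_holds T L y hT hy
  have hB0 : 0 ≤ stripGFy T L (IsBetaDart T) y := stripGFy_nonneg' T L _ hy.le
  have h1 : -(betaY y * stripGFy T L (IsBetaDart T) y) ≤ |betaY y| * K :=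
    calc -(betaY y * stripGFy T L (IsBetaDart T) y) ≤ |betaY y * stripGFy T L (IsBetaDart T) y| := neg_le_abs _
      _ = |betaY y| * stripGFy T L (IsBetaDart T) y := by rw [abs_mul, abs_of_nonneg hB0]
      _ ≤ |betaY y| * K := mul_le_mul_of_nonneg_left hB (abs_nonneg _)
  linarith

/-- `A_{T,L}(x_c;y) ≤ (1 + |β(y)| K)/cos(3π/8)` whenever `B_{T,L}(x_c;y) ≤ K` (`T ≥ 1`, `y > 0`). [cite: BeatonBousquetMelouDeGierDuminilCopinGuttmann2014, §4.1 eq. (16) (arXiv v5 p. 13)] -/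
theorem stripGFy_alpha_le_of_beta_le {T : ℕ} (hT : 1 ≤ T) (L : ℕ) {y K : ℝ} (hy : 0 < y)
    (hB : stripGFy T L (IsBetaDart T) y ≤ K) :
    stripGFy T L IsAlphaDart y ≤ (1 + |betaY y| * K) / Real.cos (3 * Real.pi / 8) := by
  have h := stripGFy_alpha_eps_le_of_beta_le hT L hy hB
  have hE : 0 ≤ stripGFy T L (IsEpsDart L) y := stripGFy_nonneg' T L _ hy.le
  have cα := cos_three_pi_div_eight_pos
  have cε := cos_pi_div_four_pos'
  rw [le_div_iff₀ cα]
  nlinarith [mul_nonneg cε.le hE]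

/-- `E_{T,L}(x_c;y) ≤ (1 + |β(y)| K)/cos(π/4)` whenever `B_{T,L}(x_c;y) ≤ K` (`T ≥ 1`, `y > 0`). [cite: BeatonBousquetMelouDeGierDuminilCopinGuttmann2014, §4.1 eq. (16) (arXiv v5 p. 13)] -/
theorem stripGFy_eps_le_of_beta_le {T : ℕ} (hT : 1 ≤ T) (L : ℕ) {y K : ℝ} (hy : 0 < y)
    (hB : stripGFy T L (IsBetaDart T) y ≤ K) :
    stripGFy T L (IsEpsDart L) y ≤ (1 + |betaY y| * K) / Real.cos (Real.pi / 4) := by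
  have h := stripGFy_alpha_eps_le_of_beta_le hT L hy hB
  have hA : 0 ≤ stripGFy T L IsAlphaDart y := stripGFy_nonneg' T L _ hy.le
  have cα := cos_three_pi_div_eight_pos
  have cε := cos_pi_div_four_pos'
  rw [le_div_iff₀ cε]
  nlinarith [mul_nonneg cα.le hA]

/-- A uniform bound on the bridge class at `y ≥ 0` from a bound at some `y' ≥ y` (monotonicity in `y`); used to dispose of `y = 0`.
[cite: BeatonBousquetMelouDeGierDuminilCopinGuttmann2014, §3.2 (arXiv v5 p. 12: series in y with nonnegative coefficients)] -/
theorem bddAbove_stripGFy_of_le (T : ℕ) (cls : HV × HV → Prop) [DecidablePred cls] {y y' : ℝ} (hy : 0 ≤ y) (hyy' : y ≤ y')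
    (hb : BddAbove (Set.range fun L : ℕ => stripGFy T L cls y')) : BddAbove (Set.range fun L : ℕ => stripGFy T L cls y) := by
  obtain ⟨K, hK⟩ := hb
  refine ⟨K, ?_⟩
  rintro _ ⟨L, rfl⟩
  exact (stripGFy_mono T L cls hy hyy').trans (hK ⟨L, rfl⟩)

/-- For `0 < y < y*` the arch and side classes are bounded by `1/c_α`, `1/c_ε` (every term of (16) is nonnegative).
[cite: BeatonBousquetMelouDeGierDuminilCopinGuttmann2014, §4.2 (arXiv v5 p. 14: for y < y* all terms of (16) are nonnegative, so A_{T,L}(x_c;y) remains bounded)] -/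
theorem stripGFy_alpha_eps_le_one_of_lt {T : ℕ} (hT : 1 ≤ T) (L : ℕ) {y : ℝ} (hy : 0 < y) (hlt : y < yStar) :
    Real.cos (3 * Real.pi / 8) * stripGFy T L IsAlphaDart y + Real.cos (Real.pi / 4) * stripGFy T L (IsEpsDart L) y ≤ 1 := by
  have hid := stripIdentityY_holds T L y hT hy
  have hB0 : 0 ≤ stripGFy T L (IsBetaDart T) y := stripGFy_nonneg' T L _ hy.le
  have hβ : 0 ≤ betaY y := by
    unfold betaY; unfold yStar at hlt
    exact div_nonneg (by linarith) (by positivity)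
  nlinarith [mul_nonneg hβ hB0]

/-- **Bounded bridges ⇒ bounded arches** (`T ≥ 1`, `y ≥ 0`): if `L ↦ B_{T,L}(x_c;y)` is bounded then so is `L ↦ A_{T,L}(x_c;y)`.
[cite: BeatonBousquetMelouDeGierDuminilCopinGuttmann2014, Corollary 8 (arXiv v5 p. 12: "The series (in y) A_T(x_c;y), B_T(x_c;y) and C_T(x_c;y) have radius of convergence y_T"); lane: the half "radius(A_T) ≥ y_T" at x = x_c, by (16)] -/
theorem bddAbove_stripGFy_alpha_of_beta {T : ℕ} (hT : 1 ≤ T) {y : ℝ} (hy : 0 ≤ y)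
    (hb : BddAbove (Set.range fun L : ℕ => stripGFy T L (IsBetaDart T) y)) :
    BddAbove (Set.range fun L : ℕ => stripGFy T L IsAlphaDart y) := by
  rcases hy.eq_or_lt with rfl | hy0
  · -- y = 0: compare with y*/2, where everything is bounded by (16)
    refine bddAbove_stripGFy_of_le T IsAlphaDart le_rfl (half_pos yStar_pos).le ⟨1 / Real.cos (3 * Real.pi / 8), ?_⟩
    rintro _ ⟨L, rfl⟩
    have h := stripGFy_alpha_eps_le_one_of_lt hT L (half_pos yStar_pos) (half_lt_self yStar_pos)
    have hE : 0 ≤ stripGFy T L (IsEpsDart L) (yStar / 2) := stripGFy_nonneg' T L _ (half_pos yStar_pos).le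
    have cα := cos_three_pi_div_eight_pos
    have cε := cos_pi_div_four_pos'
    rw [le_div_iff₀ cα]
    nlinarith [mul_nonneg cε.le hE]
  · obtain ⟨K, hK⟩ := hb
    refine ⟨(1 + |betaY y| * K) / Real.cos (3 * Real.pi / 8), ?_⟩
    rintro _ ⟨L, rfl⟩
    exact stripGFy_alpha_le_of_beta_le hT L hy0 (hK ⟨L, rfl⟩)

/-- **Bounded bridges ⇒ bounded side exits** (`T ≥ 1`, `y ≥ 0`). [cite: BeatonBousquetMelouDeGierDuminilCopinGuttmann2014, Corollary 8 (arXiv v5 p. 12) with §4.1 eq. (16) (p. 13); lane: the ε class of the trapezoid S_{T,L}] -/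
theorem bddAbove_stripGFy_eps_of_beta {T : ℕ} (hT : 1 ≤ T) {y : ℝ} (hy : 0 ≤ y)
    (hb : BddAbove (Set.range fun L : ℕ => stripGFy T L (IsBetaDart T) y)) :
    BddAbove (Set.range fun L : ℕ => stripGFy T L (IsEpsDart L) y) := by
  rcases hy.eq_or_lt with rfl | hy0
  · refine ⟨1 / Real.cos (Real.pi / 4), ?_⟩
    rintro _ ⟨L, rfl⟩
    have h := stripGFy_alpha_eps_le_one_of_lt hT L (half_pos yStar_pos) (half_lt_self yStar_pos)
    have hA : 0 ≤ stripGFy T L IsAlphaDart (yStar / 2) := stripGFy_nonneg' T L _ (half_pos yStar_pos).le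
    have hm := stripGFy_mono T L (IsEpsDart L) le_rfl (half_pos yStar_pos).le
    have cα := cos_three_pi_div_eight_pos
    have cε := cos_pi_div_four_pos'
    rw [le_div_iff₀ cε]
    nlinarith [mul_nonneg cα.le hA]
  · obtain ⟨K, hK⟩ := hb
    refine ⟨(1 + |betaY y| * K) / Real.cos (Real.pi / 4), ?_⟩
    rintro _ ⟨L, rfl⟩
    exact stripGFy_eps_le_of_beta_le hT L hy0 (hK ⟨L, rfl⟩)

/-- **The full boundary class `A + B + E` is bounded in `L` iff the bridge class is** (`T ≥ 1`, `y ≥ 0`).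
[cite: BeatonBousquetMelouDeGierDuminilCopinGuttmann2014, Corollary 8 (arXiv v5 p. 12: the common radius y_T of A_T(x_c;y), B_T(x_c;y), C_T(x_c;y)); lane: weak form at x = x_c by the identity (16)] -/
theorem bddAbove_stripGFy_all_iff {T : ℕ} (hT : 1 ≤ T) {y : ℝ} (hy : 0 ≤ y) :
    BddAbove (Set.range fun L : ℕ =>
        stripGFy T L IsAlphaDart y + stripGFy T L (IsBetaDart T) y + stripGFy T L (IsEpsDart L) y) ↔
      BddAbove (Set.range fun L : ℕ => stripGFy T L (IsBetaDart T) y) := by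
  constructor
  · rintro ⟨K, hK⟩
    refine ⟨K, ?_⟩
    rintro _ ⟨L, rfl⟩
    have h := hK ⟨L, rfl⟩
    have hA := stripGFy_nonneg' T L IsAlphaDart hy
    have hE := stripGFy_nonneg' T L (IsEpsDart L) hy
    simp only at h
    linarith
  · intro hb
    obtain ⟨KA, hKA⟩ := bddAbove_stripGFy_alpha_of_beta hT hy hb
    obtain ⟨KE, hKE⟩ := bddAbove_stripGFy_eps_of_beta hT hy hb
    obtain ⟨KB, hKB⟩ := hb
    refine ⟨KA + KB + KE, ?_⟩
    rintro _ ⟨L, rfl⟩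
    have h1 := hKA ⟨L, rfl⟩
    have h2 := hKB ⟨L, rfl⟩
    have h3 := hKE ⟨L, rfl⟩
    simp only at h1 h2 h3 ⊢
    linarith

/-- **The boundedness set of the capstone is also that of the full boundary class**:
`stripBddSet T = {y ≥ 0 : L ↦ A_{T,L}(x_c;y) + B_{T,L}(x_c;y) + E_{T,L}(x_c;y) bounded}` (`T ≥ 1`).
[cite: BeatonBousquetMelouDeGierDuminilCopinGuttmann2014, Corollary 8 (arXiv v5 p. 12: common radius y_T); lane: weak form at x = x_c] -/
theorem stripBddSet_eq_all {T : ℕ} (hT : 1 ≤ T) :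
    stripBddSet T = {y : ℝ | 0 ≤ y ∧ BddAbove (Set.range fun L : ℕ =>
      stripGFy T L IsAlphaDart y + stripGFy T L (IsBetaDart T) y + stripGFy T L (IsEpsDart L) y)} := by
  ext y
  simp only [stripBddSet, Set.mem_setOf_eq]
  constructor
  · rintro ⟨hy, hb⟩; exact ⟨hy, (bddAbove_stripGFy_all_iff hT hy).2 hb⟩
  · rintro ⟨hy, hb⟩; exact ⟨hy, (bddAbove_stripGFy_all_iff hT hy).1 hb⟩

/-- **`y_T` is the threshold of the full boundary class as well** (`T ≥ 1`).
[cite: BeatonBousquetMelouDeGierDuminilCopinGuttmann2014, Corollary 8 (arXiv v5 p. 12: "The series (in y) A_T(x_c;y), B_T(x_c;y) and C_T(x_c;y) have radius of convergence y_T"); lane: weak form at x = x_c] -/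
theorem stripYT_eq_sSup_all {T : ℕ} (hT : 1 ≤ T) :
    stripYT T = sSup {y : ℝ | 0 ≤ y ∧ BddAbove (Set.range fun L : ℕ =>
      stripGFy T L IsAlphaDart y + stripGFy T L (IsBetaDart T) y + stripGFy T L (IsEpsDart L) y)} := by
  rw [stripYT, stripBddSet_eq_all hT]

/-- **On the whole boundedness set the arch class is bounded**: `stripBddSet T ⊆ {y ≥ 0 : L ↦ A_{T,L}(x_c;y) bounded}` (`T ≥ 1`) —
the half "radius of `A_T(x_c, ·)` ≥ `y_T`" of the printed common-radius clause.
[cite: BeatonBousquetMelouDeGierDuminilCopinGuttmann2014, Corollary 8 (arXiv v5 p. 12); lane: one half, at x = x_c] -/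
theorem stripBddSet_subset_alpha {T : ℕ} (hT : 1 ≤ T) :
    stripBddSet T ⊆ {y : ℝ | 0 ≤ y ∧ BddAbove (Set.range fun L : ℕ => stripGFy T L IsAlphaDart y)} :=
  fun _ ⟨hy, hb⟩ => ⟨hy, bddAbove_stripGFy_alpha_of_beta hT hy hb⟩

/-- Below `y_T` (strictly) the arch class is bounded: `0 ≤ y < y_T ⇒ L ↦ A_{T,L}(x_c;y)` bounded (`T ≥ 1`).
[cite: BeatonBousquetMelouDeGierDuminilCopinGuttmann2014, Corollary 8 (arXiv v5 p. 12: y_T is the radius of A_T(x_c;y)); lane: the "≥" half at x = x_c] -/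
theorem bddAbove_stripGFy_alpha_of_lt_stripYT {T : ℕ} (hT : 1 ≤ T) {y : ℝ} (hy : 0 ≤ y) (hlt : y < stripYT T) :
    BddAbove (Set.range fun L : ℕ => stripGFy T L IsAlphaDart y) := by
  -- some y' with y < y' in the boundedness set (y_T is its supremum), then monotonicity in y
  have hne : (stripBddSet T).Nonempty := ⟨yStar / 2, mem_stripBddSet_of_lt hT (half_pos yStar_pos) (half_lt_self yStar_pos)⟩
  obtain ⟨y', hy'mem, hyy'⟩ := exists_lt_of_lt_csSup hne hlt
  exact bddAbove_stripGFy_of_le T IsAlphaDart hy hyy'.le (bddAbove_stripGFy_alpha_of_beta hT hy'mem.1 hy'mem.2)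

end Literature.Probability.RandomPlanarGeometry.SAW.HV
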